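import Summits.QuantumFields.YangMills.Theorems.ForcedResponseSkewnessResponseLocalisationStubSplit
import Summits.QuantumFields.YangMills.Theorems.ForcedResponseSkewnessResponseLocalisationStubShell
import HarnessLib

/-!
# Route `ForcedResponseSkewness`, item `Assembly` (stmt-QuantumFields-23618), route rev 4: the collar/far GLUE

Route-file-independent helper for the re-landed `assembly_proof` after rev 4 («RESTATE-FAR»: the deciding crux
`ResponseLocalisation` restated to its CONTACT half — a δ-collar bound — and the FAR-FIELD bound of the family member moved
into the residual `FloorWithScalingLimits`).  `relLocalisation_of_collar_far`: for ONE source `v` on a window `[1, Λ']`, a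
collar bound (tolerance `η/2`) and a far bound (tolerance `η/2`) give a Schwartz `f` with `tsupport f` disjoint from
`tsupport v`, `tsupport θv` and the RELATIVE localisation `|∂_cQ2 − Q3(f,θv,v)| ≤ η(1 + |∂_cQ2|)` — the plateau function of
the landed `Birth.stub_shell` (p589598) and the exact split of the landed `Birth.stub_split` (p589535); this is the composition
of the retired skeleton `Cruxes/ResponseLocalisation/Lines/birth_r.lean`, instantiated.  Pure bookkeeping.

Honest label: glue of a conditional rung line (leaf R2a `BalabanLadder.NT`); the YM mass gap is NOT proved by this.
-/

set_option autoImplicit false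

noncomputable section

namespace Summit.QuantumFields.YangMills.Theorems.ForcedResponseSkewness

open scoped BigOperators Topology SchwartzMap
open Filter Set MeasureTheory
open Literature.MathematicalPhysics.QuantumFieldTheory Literature.MathematicalPhysics.QuantumLattice
open Literature.Probability.LatticeModels
open Summit.QuantumFields.YangMills.Cruxes.OSLegsFromFemtoAndGap.DlrCollarTransfer
open Summit.QuantumFields.YangMills.Cruxes.ResponseLocalisation.Birth

/-- **Collar + far ⇒ relative localisation (glue).**  Collar bound (tolerance `η/2`) + far bound (tolerance `η/2`) for ONE source `v` on a window `[1, Λ']` ⇒ the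
relative localisation `|∂_cQ2 − Q3(f,θv,v)| ≤ η(1 + |∂_cQ2|)` for the plateau function `f` of `stub_shell` (landed) via
the exact split `stub_split` (landed) — the composition of the retired skeleton `birth_r`, instantiated.  [folklore] -/
theorem relLocalisation_of_collar_far (G : Type) [Group G] [TopologicalSpace G] [IsTopologicalGroup G]
    [CompactSpace G] (hG : IsCompactSimpleLieGroup G) :
    letI : MeasurableSpace G := borel G
    haveI : BorelSpace G := ⟨rfl⟩
    ∀ (r : LatticeRep G) (a : ℝ → ℝ) (v : 𝓢(EuclideanSpace ℝ (Fin 4), ℝ)) (η Λ' : ℝ), 0 < η →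
      (∃ δ : ℝ, 0 < δ ∧ ∃ β₁ Λ₁ : ℝ, ∀ β : ℝ, β₁ ≤ β → ∀ L : ℕ, Λ₁ ≤ a β * L → ∀ l : ℝ, l ∈ Set.Icc 1 Λ' →
        (∑ x ∈ box 4 L, (if Metric.infDist ((l * a β) • siteToE x) (tsupport v ∪ tsupport (thetaTest 4 v)) < δ then
          |respM G r β L (l * a β) v x| else 0)) ≤
          η / 2 * (1 + |deriv (fun c : ℝ => Q2 G r c L (l * a β) (thetaTest 4 v) v) β|)) →
      (∃ D : ℝ, 0 < D ∧ ∃ β₂ Λ₂ : ℝ, ∀ β : ℝ, β₂ ≤ β → ∀ L : ℕ, Λ₂ ≤ a β * L → ∀ l : ℝ, l ∈ Set.Icc 1 Λ' →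
        (∑ x ∈ box 4 L, (if D < ‖(l * a β) • siteToE x‖ then |respM G r β L (l * a β) v x| else 0)) ≤
          η / 2 * (1 + |deriv (fun c : ℝ => Q2 G r c L (l * a β) (thetaTest 4 v) v) β|)) →
      ∃ f : 𝓢(EuclideanSpace ℝ (Fin 4), ℝ), Disjoint (tsupport f) (tsupport v) ∧
        Disjoint (tsupport f) (tsupport (thetaTest 4 v)) ∧
        ∃ β₆ Λ₆ : ℝ, ∀ β : ℝ, β₆ ≤ β → ∀ L : ℕ, Λ₆ ≤ a β * L → ∀ l : ℝ, l ∈ Set.Icc 1 Λ' →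
          |deriv (fun c : ℝ => Q2 G r c L (l * a β) (thetaTest 4 v) v) β - Q3 G r β L (l * a β) f (thetaTest 4 v) v| ≤
            η * (1 + |deriv (fun c : ℝ => Q2 G r c L (l * a β) (thetaTest 4 v) v) β|) := by
  letI : MeasurableSpace G := borel G
  haveI : BorelSpace G := ⟨rfl⟩
  intro r a v η Λ' hη hC hF
  have hsplit : SplitSig := Summit.QuantumFields.YangMills.Cruxes.ResponseLocalisation.Birth.stub_split
  have hshell : ShellSig := Summit.QuantumFields.YangMills.Cruxes.ResponseLocalisation.Birth.stub_shell
  obtain ⟨δ, hδ, β₁, Λ₁, hC⟩ := hC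
  obtain ⟨D₀, hD₀, β₂, Λ₂, hF⟩ := hF
  have hδD : δ < max D₀ (2 * δ) := lt_of_lt_of_le (by linarith) (le_max_right _ _)
  obtain ⟨f, hfv, hfθ, hf01, hfone⟩ := hshell v δ (max D₀ (2 * δ)) hδ hδD
  refine ⟨f, hfv, hfθ, max β₁ β₂, max Λ₁ Λ₂, ?_⟩
  intro β hβ L hL l hl
  have hCβ := hC β (le_trans (le_max_left _ _) hβ) L (le_trans (le_max_left _ _) hL) l hl
  have hFβ := hF β (le_trans (le_max_right _ _) hβ) L (le_trans (le_max_right _ _) hL) l hl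
  rw [hsplit G hG r β L (l * a β) v f]
  have hpt : ∀ x ∈ box 4 L,
      |(1 - f ((l * a β) • siteToE x)) * respM G r β L (l * a β) v x| ≤
        (if Metric.infDist ((l * a β) • siteToE x) (tsupport v ∪ tsupport (thetaTest 4 v)) < δ then
            |respM G r β L (l * a β) v x| else 0) +
          (if D₀ < ‖(l * a β) • siteToE x‖ then |respM G r β L (l * a β) v x| else 0) := by
    intro x _
    set y := (l * a β) • siteToE x with hy
    set M := respM G r β L (l * a β) v x with hM
    have h01 := hf01 y
    have habs1 : |1 - f y| ≤ 1 := by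
      rw [abs_le]; constructor <;> linarith [h01.1, h01.2]
    rw [abs_mul]
    by_cases h1 : f y = 1
    · rw [h1]; simp only [sub_self, abs_zero, zero_mul]
      positivity
    · have hcase : Metric.infDist y (tsupport v ∪ tsupport (thetaTest 4 v)) < δ ∨ D₀ < ‖y‖ := by
        by_contra hcon
        rw [not_or, not_lt, not_lt] at hcon
        have hD : ‖y‖ ≤ max D₀ (2 * δ) := le_trans hcon.2 (le_max_left _ _)
        exact h1 (hfone y hcon.1 hD)
      have hMnn : 0 ≤ |M| := abs_nonneg _
      have hle1 : |1 - f y| * |M| ≤ |M| := by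
        calc |1 - f y| * |M| ≤ 1 * |M| := mul_le_mul_of_nonneg_right habs1 hMnn
          _ = |M| := one_mul _
      rcases hcase with hnear | hfar'
      · rw [if_pos hnear]
        have : 0 ≤ (if D₀ < ‖y‖ then |M| else 0) := by split_ifs <;> positivity
        linarith
      · rw [if_pos hfar']
        have : 0 ≤ (if Metric.infDist y (tsupport v ∪ tsupport (thetaTest 4 v)) < δ then |M| else 0) := by
          split_ifs <;> positivity
        linarith
  calc |∑ x ∈ box 4 L, (1 - f ((l * a β) • siteToE x)) * respM G r β L (l * a β) v x|
      ≤ ∑ x ∈ box 4 L, |(1 - f ((l * a β) • siteToE x)) * respM G r β L (l * a β) v x| :=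
        Finset.abs_sum_le_sum_abs _ _
    _ ≤ ∑ x ∈ box 4 L,
          ((if Metric.infDist ((l * a β) • siteToE x) (tsupport v ∪ tsupport (thetaTest 4 v)) < δ then
              |respM G r β L (l * a β) v x| else 0) +
            (if D₀ < ‖(l * a β) • siteToE x‖ then |respM G r β L (l * a β) v x| else 0)) :=
        Finset.sum_le_sum hpt
    _ = (∑ x ∈ box 4 L,
          (if Metric.infDist ((l * a β) • siteToE x) (tsupport v ∪ tsupport (thetaTest 4 v)) < δ then
              |respM G r β L (l * a β) v x| else 0)) +
          ∑ x ∈ box 4 L, (if D₀ < ‖(l * a β) • siteToE x‖ then |respM G r β L (l * a β) v x| else 0) :=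
        Finset.sum_add_distrib
    _ ≤ η / 2 * (1 + |deriv (fun c : ℝ => Q2 G r c L (l * a β) (thetaTest 4 v) v) β|)
          + η / 2 * (1 + |deriv (fun c : ℝ => Q2 G r c L (l * a β) (thetaTest 4 v) v) β|) := add_le_add hCβ hFβ
    _ = η * (1 + |deriv (fun c : ℝ => Q2 G r c L (l * a β) (thetaTest 4 v) v) β|) := by ring


end Summit.QuantumFields.YangMills.Theorems.ForcedResponseSkewness

end
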